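import Summits.QuantumFields.GaugeBoot.DiagonalRPTorusEvenCycleAverage
import HarnessLib

/-!
# Diagonal RP on the even two-torus, gauge-invariant sector, all couplings — IV: the averaged
kernels are Gram integrals (gauge-boot, L3 supplement)

HONEST FRAMING (cell `pub-gaugeboot`, page 1 of every file): the venture produces certified bounds
on lattice expectations at stated coupling, gauge group, dimension and torus size; NOT a mass gap,
NOT a continuum limit, NOT a string tension; NOT Yang–Mills-summit-bearing (barriers
`FixedCouplingUltralocality`, `PerturbativeInvisibility`). This module is part of a POSITIVE
structural result (`DiagonalRPTorusEvenGaugeInvariantAllGroups.lean`).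

For EVEN `L = 2(m+1)` the convolution power `w^{⋆L}` of the Wilson weight is a convolution SQUARE
`u ⋆ u`, `u = w^{⋆(m+1)}` (`halfPow`, `cpow_eq_conv_halfPow`), so by `ClassConv.twoSided_conv` and
`twoSided_symm` the two averaged cut kernels of part III are Gram integrals:

* `mirK_eq_integral`: `A_{w^{⋆L}}(stairC L U, stairD L U) = ∫ A_u(stairC L U, k) A_u(stairC L (ΘU), k) dk`
  (`stairD L U = stairC L (ΘU)`);
* `backK_eq_integral`: `A_{w^{⋆L}}(stairDc L U, stairCc L U) = ∫ A_u(stairDc L U, k) A_u(stairDc L (ΘU), k) dk`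
  — here the swap acts on the back layer as a half-turn, so `stairDc L (ΘU)` is a CONJUGATE of
  `stairCc L U` (`prod_map_range_rotate`: a rotated cyclic product is a conjugate;
  `stairDc_configDiagSwap`, `twoSided_stairCc_eq`);
* `stairC_congr`, `stairDc_congr`: both staircases read only closed-half links.

No sign condition on `β` and no character theory enter. References: A. A. Migdal, Sov. Phys. JETP
42 (1975) 413; J.-M. Drouffe, J.-B. Zuber, Phys. Rep. 102 (1983) 1, §3.
-/

open MeasureTheory Complex Finset Function
open scoped ComplexOrder ENNReal

namespace Summit.QuantumFields.GaugeBoot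

open Literature.MathematicalPhysics.QuantumFieldTheory
open Literature.RepresentationTheory.CompactGroups

noncomputable section

namespace DiagRPTwo

/-! ## A rotated cyclic product is a conjugate -/

section Rotation

variable {G : Type*} [Group G]

/-- Splitting a product along `List.range (a + b)`. -/
theorem prod_map_range_add (f : ℕ → G) (a b : ℕ) :
    ((List.range (a + b)).map f).prod =
      ((List.range a).map f).prod * ((List.range b).map fun t => f (a + t)).prod := by
  rw [List.range_add, List.map_append, List.prod_append, List.map_map]
  rfl

/-- **A rotation of a cyclic product is a conjugate of it**: for an `L`-periodic sequence `f`
and `c ≤ L`, `∏_{t<L} f(t + c) = P⁻¹ (∏_{t<L} f t) P` with `P = ∏_{t<c} f t`. -/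
theorem prod_map_range_rotate {f : ℕ → G} {L c : ℕ} (hf : ∀ t, f (t + L) = f t) (hc : c ≤ L) :
    ((List.range L).map fun t => f (t + c)).prod =
      (((List.range c).map f).prod)⁻¹ * ((List.range L).map f).prod * ((List.range c).map f).prod := by
  obtain ⟨b, rfl⟩ := Nat.exists_eq_add_of_le hc
  rw [prod_map_range_add f c b, show c + b = b + c by ring, prod_map_range_add _ b c]
  have h1 : ((List.range b).map fun t => f (t + c)) = (List.range b).map fun t => f (c + t) := by
    refine List.map_congr_left fun t _ => ?_; rw [add_comm]
  have h2 : ((List.range c).map fun t => f (b + t + c)) = (List.range c).map f := by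
    refine List.map_congr_left fun t _ => ?_
    rw [show b + t + c = t + (c + b) by ring, hf]
  rw [h1, h2]
  group

end Rotation

/-! ## The staircases read only closed-half links; the back-layer staircase of `ΘU` -/

section Stairs

variable {L : ℕ} [NeZero L] {G : Type*} [Group G] {i j : Fin 2}

/-- The mirror staircase reads only closed-half links. -/
theorem stairC_congr (h4 : 4 ≤ L) (hij : i ≠ j) {U V : GaugeConfig 2 L G}
    (hUV : ∀ e ∈ (halfLinks (L := L) i j : Set (Edge 2 L)), U e = V e) (n : ℕ) :
    stairC i j n U = stairC i j n V := by
  have hC : ∀ t, cT i j U (dg t) = cT i j V (dg t) := fun t => by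
    obtain ⟨h1, h2⟩ := inHalf_cT_links h4 hij (kd_dg i j t)
    simp only [cT, hUV _ (Finset.mem_coe.2 (mem_halfLinks.2 h1)), hUV _ (Finset.mem_coe.2 (mem_halfLinks.2 h2))]
  induction n with
  | zero => simp
  | succ n ih => rw [stairC_succ, stairC_succ, ih, hC]

/-- The back-layer staircase reads only closed-half links. -/
theorem stairDc_congr (h4 : 4 ≤ L) (hij : i ≠ j) {U V : GaugeConfig 2 L G}
    (hUV : ∀ e ∈ (halfLinks (L := L) i j : Set (Edge 2 L)), U e = V e) (n : ℕ) :
    stairDc i j n U = stairDc i j n V := by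
  have hD : ∀ t, dT i j U (dgc i t) = dT i j V (dgc i t) := fun t => by
    obtain ⟨h1, h2⟩ := inHalf_dT_links h4 hij (kd_dgc hij t)
    simp only [dT, hUV _ (Finset.mem_coe.2 (mem_halfLinks.2 h1)), hUV _ (Finset.mem_coe.2 (mem_halfLinks.2 h2))]
  induction n with
  | zero => simp
  | succ n ih => rw [stairDc_succ, stairDc_succ, ih, hD]

/-- **The swap turns the back-layer staircase into a conjugate of the opposite one**:
`stairDc L (ΘU) = P⁻¹ · stairCc L U · P` (`L` even; the swap is the half-turn of the layer). -/
theorem stairDc_configDiagSwap (hL : Even L) (hij : i ≠ j) (U : GaugeConfig 2 L G) :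
    stairDc i j L (configDiagSwap i j U) =
      (((List.range (L / 2)).map fun t => cT i j U (dgc i t)).prod)⁻¹ * stairCc i j L U *
        ((List.range (L / 2)).map fun t => cT i j U (dgc i t)).prod := by
  have h1 : stairDc i j L (configDiagSwap i j U) =
      ((List.range L).map fun t => cT i j U (dgc i (t + L / 2))).prod := by
    simp only [stairDc, dT_configDiagSwap, siteDiagSwap_dgc hL hij]
  rw [h1, prod_map_range_rotate (f := fun t => cT i j U (dgc i t)) (fun t => by
    simp only [dgc_add_L]) (Nat.div_le_self L 2)]
  rfl

end Stairs

/-! ## The kernels as integrals of products -/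

section Kernels

variable {L N : ℕ} [NeZero L] {G : Type*} [Group G] [TopologicalSpace G] [IsTopologicalGroup G]
  [CompactSpace G] [MeasurableSpace G] [BorelSpace G] [SecondCountableTopology G]
  (ρ : G →* Matrix (Fin N) (Fin N) ℂ) {i j : Fin 2} (β : ℝ)

/-- The half convolution power `u = w^{⋆(n/2)}` of the Wilson weight (`n` = the torus size). -/
def halfPow (n : ℕ) : G → ℝ := ClassConv.cpow (TwistedSlab.wilsonWeight ρ β) (n / 2 - 1)

variable {ρ β}

omit [NeZero L] [SecondCountableTopology G] in
/-- `u` is a class function. -/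
theorem halfPow_conj (g k : G) : halfPow ρ β L (g * k * g⁻¹) = halfPow ρ β L k :=
  ClassConv.cpow_conj (TwistedSlab.wilsonWeight_conj ρ β) _ g k

omit [NeZero L] [SecondCountableTopology G] in
/-- `u` is inversion symmetric. -/
theorem halfPow_inv (hρ : Continuous ρ) (k : G) : halfPow ρ β L k⁻¹ = halfPow ρ β L k :=
  ClassConv.cpow_inv (TwistedSlab.wilsonWeight_conj ρ β) (TwistedSlab.wilsonWeight_inv ρ hρ β) _ k

omit [NeZero L] in
/-- `u` is continuous. -/
theorem continuous_halfPow (hρ : Continuous ρ) : Continuous (halfPow (G := G) ρ β L) :=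
  ClassConv.continuous_cpow (TwistedSlab.continuous_wilsonWeight ρ hρ β) _

omit [NeZero L] in
/-- `w^{⋆L} = u ⋆ u` for even `L ≥ 4`. -/
theorem cpow_eq_conv_halfPow (hL : Even L) (h4 : 4 ≤ L) (hρ : Continuous ρ) :
    ClassConv.cpow (TwistedSlab.wilsonWeight ρ β) (L - 1) =
      ClassConv.conv (halfPow ρ β L) (halfPow (G := G) ρ β L) := by
  obtain ⟨r, hr⟩ := hL
  have hm : L / 2 - 1 + (L / 2 - 1) + 1 = L - 1 := by omega
  rw [halfPow, ClassConv.conv_cpow_cpow (TwistedSlab.continuous_wilsonWeight ρ hρ β), hm]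

omit [SecondCountableTopology G] in
/-- The opposite back-layer staircase may be replaced by the back-layer staircase of `ΘU` inside
the two-sided average (rotation = conjugation). -/
theorem twoSided_stairCc_eq (hL : Even L) (hij : i ≠ j) (U : GaugeConfig 2 L G) (D : G) :
    ClassConv.twoSided (halfPow ρ β L) (stairCc i j L U) D =
      ClassConv.twoSided (halfPow ρ β L) (stairDc i j L (configDiagSwap i j U)) D := by
  rw [stairDc_configDiagSwap hL hij U]
  set P := ((List.range (L / 2)).map fun t => cT i j U (dgc i t)).prod
  have h : P⁻¹ * stairCc i j L U * P = P⁻¹ * stairCc i j L U * P⁻¹⁻¹ := by rw [inv_inv]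
  rw [h, ClassConv.twoSided_conj_left]

omit [NeZero L] in
/-- ★ **The mirror kernel as a Gram integral**:
`A_{w^{⋆L}}(stairC L U, stairD L U) = ∫ A_u(stairC L U, k) A_u(stairC L (ΘU), k) dk`. -/
theorem mirK_eq_integral (hL : Even L) (h4 : 4 ≤ L) (hρ : Continuous ρ) (U : GaugeConfig 2 L G) :
    mirK ρ i j β U = ∫ k, ClassConv.twoSided (halfPow ρ β L) (stairC i j L U) k *
      ClassConv.twoSided (halfPow ρ β L) (stairC i j L (configDiagSwap i j U)) k ∂(haarProbability G) := by
  rw [mirK, cpow_eq_conv_halfPow hL h4 hρ, ClassConv.twoSided_conv (continuous_halfPow hρ)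
    (continuous_halfPow hρ) halfPow_conj halfPow_conj]
  refine integral_congr_ae (ae_of_all _ fun k => ?_)
  dsimp only
  rw [ClassConv.twoSided_symm halfPow_conj (halfPow_inv hρ) k, stairC_configDiagSwap]

/-- ★ **The back-layer kernel as a Gram integral**:
`A_{w^{⋆L}}(stairDc L U, stairCc L U) = ∫ A_u(stairDc L U, k) A_u(stairDc L (ΘU), k) dk`. -/
theorem backK_eq_integral (hL : Even L) (h4 : 4 ≤ L) (hij : i ≠ j) (hρ : Continuous ρ)
    (U : GaugeConfig 2 L G) :
    backK ρ i j β U = ∫ k, ClassConv.twoSided (halfPow ρ β L) (stairDc i j L U) k *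
      ClassConv.twoSided (halfPow ρ β L) (stairDc i j L (configDiagSwap i j U)) k ∂(haarProbability G) := by
  rw [backK, cpow_eq_conv_halfPow hL h4 hρ, ClassConv.twoSided_conv (continuous_halfPow hρ)
    (continuous_halfPow hρ) halfPow_conj halfPow_conj]
  refine integral_congr_ae (ae_of_all _ fun k => ?_)
  dsimp only
  rw [ClassConv.twoSided_symm halfPow_conj (halfPow_inv hρ) k, twoSided_stairCc_eq hL hij]

end Kernels


end DiagRPTwo

end

end Summit.QuantumFields.GaugeBoot
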